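import Literature.ComputerArithmetic.Roux2014.Optimality
import Summits.Ventures.CertifiedArithmetic.Expansions.CompressScaling
import Summits.Ventures.CertifiedArithmetic.Expansions.CompressStaircaseFixedPoint
import Mathlib.Tactic.Linarith
import Mathlib.Tactic.Positivity
import Mathlib.Tactic.Ring
import Mathlib.Tactic.NormNum

/-!
# The precision-2 ripple: blocks, roundings and chains for COMPRESS at `p = 2` (new work)

New work of the certified-arithmetic venture (ENGINES group: shared numerical engines serving
client cells; rigour lives in the verifiers; every published number belongs to a client cell's
ledger, not to the engines group).  NOT a published theorem: Shewchuk [Shewchuk1997, §2.7] proves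
Theorem 23 about ONE pass of COMPRESS and says nothing about iterating it.
`CompressPassesUnboundedGeneric.lean` shows that at every precision `p ≥ 3` the number of
COMPRESS passes needed to reach the fixed point is unbounded in the length of the expansion; its
travelling-kink family needs `p ≥ 3` (the tie of its window), and at `p = 2` only a three-pass
example was known (`CompressThreePasses.lean`).  This file and
`CompressPassesUnboundedPrecTwo.lean` close the gap with a DIFFERENT mechanism, found by
exhaustive search at `p = 2`: not a local kink travelling down a staircase but a GLOBAL RIPPLE in
which every component changes at every pass.  The expansion is built from two kinds of blocks
(IEEE ties-to-even `roundTiesEven 2 emin`, `emin ≤ 0`, significands `1` and `3` only):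
* `zig3 σ e n = [σ·3·2^e, −σ·3·2^(e+3), σ·3·2^(e+6), …]` — `n` KINKS of alternating sign, ratio 8;
* `ramp2 τ e n = [τ·2^e, τ·2^(e+2), …]` — a RUN of `n` powers of two of one sign, ratio 4.
Here we prove the ingredients of one pass: the six roundings `RN₂(±11·2^s) = ±12·2^s`,
`RN₂(±5·2^s) = ±4·2^s` (ties to even), `RN₂(±21·2^s) = ±24·2^s`; the one ACTIVE step
`FastTwoSum(σ·2^(e+3), σ·3·2^e) = (σ·3·2^(e+2), −σ·2^e)` (`f2s_kink`); the three INERT links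
(`link_run`, `link_alt`, `link_cross`: run–run, kink–kink and run-top–kink neighbours absorb
each other in the sense of `compress_eq_self_of_isChain`); that runs, kink blocks and a run
followed by a kink block are chains (`isChain_ramp2`, `isChain_zig3`, `isChain_ramp2_zig3`); and
that the blocks are nonoverlapping expansions of precision-2 floats (`isExpansion_zig3`,
`isExpansion_ramp2`, `grid_of_mem_*`, `isFloat_of_mem_*`).  The sweeps, the states and the pass
count are in `CompressPassesUnboundedPrecTwo.lean`.

References: J. R. Shewchuk, Discrete Comput. Geom. 18 (1997) 305–363, §2.7 [Shewchuk1997];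
rounding to nearest even [BoldoEtAl2023, §2.2]; floats `M·2^e`, `|M| < 2^p` [JeannerodRump2018].
-/

namespace Summit.Ventures.CertifiedArithmetic.Expansions

open Literature.ComputerArithmetic.JeannerodRump2018
open Literature.ComputerArithmetic.BoldoJeannerodMelquiondMuller2023 hiding twoSum twoSum_fst
open Literature.ComputerArithmetic.Shewchuk1997
open Literature.ComputerArithmetic.Roux2014

variable {em emin : ℤ} {σ τ : ℚ}

/-- `RN₂(11) = 12` (`11 = 2·4 + 3`, nearer to `3·4`). [cite: BoldoEtAl2023, §2.2] -/
theorem rne2_11 (he : em ≤ 0) : roundTiesEven 2 em 11 = 12 := by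
  have hu : ulp 2 em (11 : ℚ) = (2 : ℚ) ^ (2 : ℤ) :=
    ulp_eq_two_zpow_of_bounds (by norm_num) (by omega) (by norm_num) (by norm_num)
  have hn : ⌊(11 : ℚ) / (2 : ℚ) ^ (2 : ℤ)⌋ = 2 := by norm_num [Int.floor_eq_iff]
  rw [roundTiesEven_of_lt_right hu hn (by norm_num)]; norm_num

/-- `RN₂(−11) = −12`. [cite: BoldoEtAl2023, §2.2] -/
theorem rne2_neg11 (he : em ≤ 0) : roundTiesEven 2 em (-11) = -12 := by
  have hu : ulp 2 em (-11 : ℚ) = (2 : ℚ) ^ (2 : ℤ) :=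
    ulp_eq_two_zpow_of_bounds (by norm_num) (by omega) (by norm_num) (by norm_num)
  have hn : ⌊(-11 : ℚ) / (2 : ℚ) ^ (2 : ℤ)⌋ = -3 := by norm_num [Int.floor_eq_iff]
  rw [roundTiesEven_of_lt_left hu hn (by norm_num)]; norm_num

/-- `RN₂(5) = 4` — the tie `5 = 2·2 + 1` goes to the even significand `2`.
[cite: BoldoEtAl2023, §2.2] -/
theorem rne2_5 (he : em ≤ 0) : roundTiesEven 2 em 5 = 4 := by
  have hu : ulp 2 em (5 : ℚ) = (2 : ℚ) ^ (1 : ℤ) :=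
    ulp_eq_two_zpow_of_bounds (by norm_num) (by omega) (by norm_num) (by norm_num)
  have hn : ⌊(5 : ℚ) / (2 : ℚ) ^ (1 : ℤ)⌋ = 2 := by norm_num [Int.floor_eq_iff]
  rw [roundTiesEven_of_tie_even hu hn (by norm_num) (by norm_num)]; norm_num

/-- `RN₂(−5) = −4` — the tie goes to the even significand `−2`. [cite: BoldoEtAl2023, §2.2] -/
theorem rne2_neg5 (he : em ≤ 0) : roundTiesEven 2 em (-5) = -4 := by
  have hu : ulp 2 em (-5 : ℚ) = (2 : ℚ) ^ (1 : ℤ) :=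
    ulp_eq_two_zpow_of_bounds (by norm_num) (by omega) (by norm_num) (by norm_num)
  have hn : ⌊(-5 : ℚ) / (2 : ℚ) ^ (1 : ℤ)⌋ = -3 := by norm_num [Int.floor_eq_iff]
  rw [roundTiesEven_of_tie_odd hu hn (by norm_num) (by decide)]; norm_num

/-- `RN₂(21) = 24` (`21 = 2·8 + 5`, nearer to `3·8`). [cite: BoldoEtAl2023, §2.2] -/
theorem rne2_21 (he : em ≤ 0) : roundTiesEven 2 em 21 = 24 := by
  have hu : ulp 2 em (21 : ℚ) = (2 : ℚ) ^ (3 : ℤ) :=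
    ulp_eq_two_zpow_of_bounds (by norm_num) (by omega) (by norm_num) (by norm_num)
  have hn : ⌊(21 : ℚ) / (2 : ℚ) ^ (3 : ℤ)⌋ = 2 := by norm_num [Int.floor_eq_iff]
  rw [roundTiesEven_of_lt_right hu hn (by norm_num)]; norm_num

/-- `RN₂(−21) = −24`. [cite: BoldoEtAl2023, §2.2] -/
theorem rne2_neg21 (he : em ≤ 0) : roundTiesEven 2 em (-21) = -24 := by
  have hu : ulp 2 em (-21 : ℚ) = (2 : ℚ) ^ (3 : ℤ) :=
    ulp_eq_two_zpow_of_bounds (by norm_num) (by omega) (by norm_num) (by norm_num)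
  have hn : ⌊(-21 : ℚ) / (2 : ℚ) ^ (3 : ℤ)⌋ = -3 := by norm_num [Int.floor_eq_iff]
  rw [roundTiesEven_of_lt_left hu hn (by norm_num)]; norm_num

/-! ### Blocks of the ripple family -/

/-- `zig3 σ e n`: the `n` components `σ·3·2^e, −σ·3·2^(e+3), σ·3·2^(e+6), …` (smallest first). -/
def zig3 (σ : ℚ) (e : ℕ) : ℕ → List ℚ
  | 0 => []
  | n + 1 => σ * 3 * 2 ^ e :: zig3 (-σ) (e + 3) n

/-- `ramp2 τ e n`: the `n` components `τ·2^e, τ·2^(e+2), …, τ·2^(e+2(n−1))` (smallest first). -/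
def ramp2 (τ : ℚ) (e : ℕ) : ℕ → List ℚ
  | 0 => []
  | n + 1 => τ * 2 ^ e :: ramp2 τ (e + 2) n

/-- Unfolding. -/
@[simp] theorem zig3_zero (σ : ℚ) (e : ℕ) : zig3 σ e 0 = [] := rfl
/-- Unfolding. -/
@[simp] theorem zig3_succ (σ : ℚ) (e n : ℕ) :
    zig3 σ e (n + 1) = σ * 3 * 2 ^ e :: zig3 (-σ) (e + 3) n := rfl
/-- Unfolding. -/
@[simp] theorem ramp2_zero (τ : ℚ) (e : ℕ) : ramp2 τ e 0 = [] := rfl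
/-- Unfolding. -/
@[simp] theorem ramp2_succ (τ : ℚ) (e n : ℕ) :
    ramp2 τ e (n + 1) = τ * 2 ^ e :: ramp2 τ (e + 2) n := rfl

/-- The last component of `zig3`: `zig3 σ e (n+1) = zig3 σ e n ++ [σ·(−1)^n·3·2^(e+3n)]`. -/
theorem zig3_succ_eq_append (σ : ℚ) : ∀ (e n : ℕ),
    zig3 σ e (n + 1) = zig3 σ e n ++ [σ * (-1) ^ n * 3 * 2 ^ (e + 3 * n)]
  | e, 0 => by simp
  | e, n + 1 => by
    rw [zig3_succ, zig3_succ_eq_append (-σ) (e + 3) n, zig3_succ, List.cons_append]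
    congr 2
    rw [show e + 3 + 3 * n = e + 3 * (n + 1) by ring, pow_succ]
    ring

/-- The last component of `ramp2`: `ramp2 τ e (n+1) = ramp2 τ e n ++ [τ·2^(e+2n)]`. -/
theorem ramp2_succ_eq_append (τ : ℚ) : ∀ (e n : ℕ),
    ramp2 τ e (n + 1) = ramp2 τ e n ++ [τ * 2 ^ (e + 2 * n)]
  | e, 0 => by simp
  | e, n + 1 => by
    rw [ramp2_succ, ramp2_succ_eq_append τ (e + 2) n, ramp2_succ, List.cons_append,
      show e + 2 + 2 * n = e + 2 * (n + 1) by ring]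

/-- Lengths. -/
@[simp] theorem length_zig3 (σ : ℚ) : ∀ (e n : ℕ), (zig3 σ e n).length = n
  | e, 0 => rfl
  | e, n + 1 => by rw [zig3_succ, List.length_cons, length_zig3]
/-- Lengths. -/
@[simp] theorem length_ramp2 (τ : ℚ) : ∀ (e n : ℕ), (ramp2 τ e n).length = n
  | e, 0 => rfl
  | e, n + 1 => by rw [ramp2_succ, List.length_cons, length_ramp2]

/-! ### Roundings and floats in the binade `2^s` at precision 2 -/

/-- `±1·2^s` and `±3·2^s` are precision-2 floats (`emin ≤ 0 ≤ s`). [cite: JeannerodRump2018, §1] -/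
theorem isFloat2_sign_mul (he : emin ≤ 0) (hσ : σ = 1 ∨ σ = -1) {c : ℚ} (hc : c = 1 ∨ c = 3)
    (s : ℕ) : IsFloat 2 emin (σ * c * 2 ^ s) := by
  rcases hσ with rfl | rfl <;> rcases hc with rfl | rfl
  · exact ⟨1, s, by norm_num, by omega, by rw [zpow_natCast]; ring⟩
  · exact ⟨3, s, by norm_num, by omega, by rw [zpow_natCast]; ring⟩
  · exact ⟨-1, s, by norm_num, by omega, by rw [zpow_natCast]; push_cast; ring⟩
  · exact ⟨-3, s, by norm_num, by omega, by rw [zpow_natCast]; push_cast; ring⟩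

section rounding
variable (he : emin ≤ 0)
include he

/-- A base rounding `RN₂,em(a) = r` (all `em ≤ 0`) read in the binade `2^s`.
[cite: BoldoEtAl2023, §2.2] -/
theorem rn2_sc (s : ℕ) {a r : ℚ} (h : ∀ em : ℤ, em ≤ 0 → roundTiesEven 2 em a = r) :
    roundTiesEven 2 emin (a * 2 ^ s) = r * 2 ^ s := by
  rw [← zpow_natCast, roundTiesEven_mul_two_zpow, h _ (by omega)]

/-- `RN₂(σ·11·2^s) = σ·12·2^s`. [cite: BoldoEtAl2023, §2.2] -/
theorem rne2_11_sc (hσ : σ = 1 ∨ σ = -1) (s : ℕ) :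
    roundTiesEven 2 emin (σ * 11 * 2 ^ s) = σ * 12 * 2 ^ s := by
  refine rn2_sc he s fun em hem => ?_
  rcases hσ with rfl | rfl
  · rw [one_mul, one_mul]; exact rne2_11 hem
  · rw [show (-1 : ℚ) * 11 = -11 by norm_num, show (-1 : ℚ) * 12 = -12 by norm_num]
    exact rne2_neg11 hem

/-- `RN₂(σ·5·2^s) = σ·4·2^s` (ties to even). [cite: BoldoEtAl2023, §2.2] -/
theorem rne2_5_sc (hσ : σ = 1 ∨ σ = -1) (s : ℕ) :
    roundTiesEven 2 emin (σ * 5 * 2 ^ s) = σ * 4 * 2 ^ s := by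
  refine rn2_sc he s fun em hem => ?_
  rcases hσ with rfl | rfl
  · rw [one_mul, one_mul]; exact rne2_5 hem
  · rw [show (-1 : ℚ) * 5 = -5 by norm_num, show (-1 : ℚ) * 4 = -4 by norm_num]
    exact rne2_neg5 hem

/-- `RN₂(σ·21·2^s) = σ·24·2^s`. [cite: BoldoEtAl2023, §2.2] -/
theorem rne2_21_sc (hσ : σ = 1 ∨ σ = -1) (s : ℕ) :
    roundTiesEven 2 emin (σ * 21 * 2 ^ s) = σ * 24 * 2 ^ s := by
  refine rn2_sc he s fun em hem => ?_
  rcases hσ with rfl | rfl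
  · rw [one_mul, one_mul]; exact rne2_21 hem
  · rw [show (-1 : ℚ) * 21 = -21 by norm_num, show (-1 : ℚ) * 24 = -24 by norm_num]
    exact rne2_neg21 hem

/-- Floats round to themselves: `RN₂(σ·c·2^s) = σ·c·2^s` for `c ∈ {1, 3}`.
[cite: BoldoEtAl2023, §2.2] -/
theorem rne2_self (hσ : σ = 1 ∨ σ = -1) {c : ℚ} (hc : c = 1 ∨ c = 3) (s : ℕ) :
    roundTiesEven 2 emin (σ * c * 2 ^ s) = σ * c * 2 ^ s :=
  roundTiesEven_eq_self (by norm_num) (isFloat2_sign_mul he hσ hc s)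

/-- THE ACTIVE STEP of the ripple: `FAST-TWO-SUM(σ·2^(e+3), σ·3·2^e) = (σ·3·2^(e+2), −σ·2^e)`
(`RN₂(11·2^e) = 12·2^e`, then two exact operations). [cite: Shewchuk1997, Thm 6 p. 312] -/
theorem f2s_kink (hσ : σ = 1 ∨ σ = -1) (e : ℕ) :
    fastTwoSum (roundTiesEven 2 emin) (σ * 2 ^ (e + 3)) (σ * 3 * 2 ^ e) =
      (σ * 3 * 2 ^ (e + 2), -σ * 2 ^ e) := by
  have hnσ : -σ = 1 ∨ -σ = -1 := by rcases hσ with rfl | rfl <;> norm_num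
  have h8 : σ * 2 ^ (e + 3) + σ * 3 * 2 ^ e = σ * 11 * 2 ^ e := by rw [pow_add]; ring
  have h12 : σ * 12 * 2 ^ e - σ * 2 ^ (e + 3) = σ * 1 * 2 ^ (e + 2) := by
    rw [pow_add, pow_add]; ring
  have h3 : σ * 3 * 2 ^ e - σ * 1 * 2 ^ (e + 2) = -σ * 1 * 2 ^ e := by rw [pow_add]; ring
  simp only [fastTwoSum]
  rw [h8, rne2_11_sc he hσ, h12, rne2_self he hσ (Or.inl rfl), h3, rne2_self he hnσ (Or.inl rfl)]
  refine Prod.ext ?_ ?_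
  · show σ * 12 * 2 ^ e = σ * 3 * 2 ^ (e + 2)
    rw [pow_add]; ring
  · show -σ * 1 * 2 ^ e = -σ * 2 ^ e
    ring

/-! ### The three inert links (relation of `compress_eq_self_of_isChain`, smallest first) -/

/-- Run link: `RN₂(τ·2^(e+2) + τ·2^e) = τ·2^(e+2)` (the tie `5 → 4`).
[cite: Shewchuk1997, §2.7 p. 332] -/
theorem link_run (hτ : τ = 1 ∨ τ = -1) (e : ℕ) :
    roundTiesEven 2 emin (τ * 2 ^ (e + 2) + τ * 2 ^ e) = τ * 2 ^ (e + 2) ∧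
      roundTiesEven 2 emin (τ * 2 ^ e) = τ * 2 ^ e ∧ τ * 2 ^ e ≠ 0 := by
  refine ⟨?_, by simpa using rne2_self he hτ (Or.inl rfl) e, ?_⟩
  · rw [show τ * 2 ^ (e + 2) + τ * 2 ^ e = τ * 5 * 2 ^ e by rw [pow_add]; ring, rne2_5_sc he hτ,
      pow_add]; ring
  · rcases hτ with rfl | rfl <;> positivity

/-- Kink link: `RN₂(−σ·3·2^(e+3) + σ·3·2^e) = −σ·3·2^(e+3)` (`21 → 24`).
[cite: Shewchuk1997, §2.7 p. 332] -/
theorem link_alt (hσ : σ = 1 ∨ σ = -1) (e : ℕ) :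
    roundTiesEven 2 emin (-σ * 3 * 2 ^ (e + 3) + σ * 3 * 2 ^ e) = -σ * 3 * 2 ^ (e + 3) ∧
      roundTiesEven 2 emin (σ * 3 * 2 ^ e) = σ * 3 * 2 ^ e ∧ σ * 3 * 2 ^ e ≠ 0 := by
  have hnσ : -σ = 1 ∨ -σ = -1 := by rcases hσ with rfl | rfl <;> norm_num
  refine ⟨?_, rne2_self he hσ (Or.inr rfl) e, ?_⟩
  · rw [show -σ * 3 * 2 ^ (e + 3) + σ * 3 * 2 ^ e = -σ * 21 * 2 ^ e by rw [pow_add]; ring,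
      rne2_21_sc he hnσ, pow_add]; ring
  · rcases hσ with rfl | rfl <;> norm_num
    
/-- Cross link: `RN₂(−τ·3·2^(e+2) + τ·2^e) = −τ·3·2^(e+2)` (`−11 → −12`).
[cite: Shewchuk1997, §2.7 p. 332] -/
theorem link_cross (hτ : τ = 1 ∨ τ = -1) (e : ℕ) :
    roundTiesEven 2 emin (-τ * 3 * 2 ^ (e + 2) + τ * 2 ^ e) = -τ * 3 * 2 ^ (e + 2) ∧
      roundTiesEven 2 emin (τ * 2 ^ e) = τ * 2 ^ e ∧ τ * 2 ^ e ≠ 0 := by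
  have hnτ : -τ = 1 ∨ -τ = -1 := by rcases hτ with rfl | rfl <;> norm_num
  refine ⟨?_, by simpa using rne2_self he hτ (Or.inl rfl) e, ?_⟩
  · rw [show -τ * 3 * 2 ^ (e + 2) + τ * 2 ^ e = -τ * 11 * 2 ^ e by rw [pow_add]; ring,
      rne2_11_sc he hnτ, pow_add]; ring
  · rcases hτ with rfl | rfl <;> positivity

end rounding

/-! ### Chains -/

/-- `RN₂(0) = 0`. [cite: BoldoEtAl2023, §2.2] -/
theorem rne2_zero : roundTiesEven 2 emin 0 = 0 :=
  roundTiesEven_eq_self (by norm_num) ⟨0, emin, by norm_num, le_rfl, by simp⟩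

section sweeps
variable (he : emin ≤ 0)
include he

/-- A run is a chain: each component is absorbed by the next (`5 → 4`).
[cite: Shewchuk1997, §2.7 p. 332] -/
theorem isChain_ramp2 : ∀ (n e : ℕ) (τ : ℚ), (τ = 1 ∨ τ = -1) →
    List.IsChain (fun a b => roundTiesEven 2 emin (b + a) = b ∧ roundTiesEven 2 emin a = a ∧ a ≠ 0)
      (ramp2 τ e n)
  | 0, e, τ, hτ => List.IsChain.nil
  | 1, e, τ, hτ => by simp [List.IsChain.singleton]
  | n + 2, e, τ, hτ => by
    rw [ramp2_succ, ramp2_succ]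
    refine List.isChain_cons_cons.mpr ⟨link_run he hτ e, ?_⟩
    have := isChain_ramp2 (n + 1) (e + 2) τ hτ
    rwa [ramp2_succ] at this

/-- A kink block is a chain (`21 → 24`). [cite: Shewchuk1997, §2.7 p. 332] -/
theorem isChain_zig3 : ∀ (n e : ℕ) (σ : ℚ), (σ = 1 ∨ σ = -1) →
    List.IsChain (fun a b => roundTiesEven 2 emin (b + a) = b ∧ roundTiesEven 2 emin a = a ∧ a ≠ 0)
      (zig3 σ e n)
  | 0, e, σ, hσ => List.IsChain.nil
  | 1, e, σ, hσ => by simp [List.IsChain.singleton]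
  | n + 2, e, σ, hσ => by
    have hnσ : -σ = 1 ∨ -σ = -1 := by rcases hσ with rfl | rfl <;> norm_num
    rw [zig3_succ, zig3_succ]
    refine List.isChain_cons_cons.mpr ⟨link_alt he hσ e, ?_⟩
    have := isChain_zig3 (n + 1) (e + 3) (-σ) hnσ
    rwa [zig3_succ] at this

/-- A component linked below a kink block gives a chain. [cite: Shewchuk1997, §2.7 p. 332] -/
theorem isChain_cons_zig3 {σ a : ℚ} (hσ : σ = 1 ∨ σ = -1) (e k : ℕ)
    (h : roundTiesEven 2 emin (σ * 3 * 2 ^ e + a) = σ * 3 * 2 ^ e ∧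
      roundTiesEven 2 emin a = a ∧ a ≠ 0) :
    List.IsChain (fun a b => roundTiesEven 2 emin (b + a) = b ∧ roundTiesEven 2 emin a = a ∧ a ≠ 0)
      (a :: zig3 σ e k) := by
  cases k with
  | zero => simp [List.IsChain.singleton]
  | succ k =>
    rw [zig3_succ]
    exact List.isChain_cons_cons.mpr ⟨h, by rw [← zig3_succ]; exact isChain_zig3 he _ _ _ hσ⟩

/-- A run followed by a kink block of the opposite sign two binades up is a chain.
[cite: Shewchuk1997, §2.7 p. 332] -/
theorem isChain_ramp2_zig3 (hτ : τ = 1 ∨ τ = -1) : ∀ (n e m : ℕ),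
    List.IsChain (fun a b => roundTiesEven 2 emin (b + a) = b ∧ roundTiesEven 2 emin a = a ∧ a ≠ 0)
      (ramp2 τ e (n + 1) ++ zig3 (-τ) (e + 2 * n + 2) m)
  | 0, e, m => by
    rw [ramp2_succ, ramp2_zero, List.singleton_append, show e + 2 * 0 + 2 = e + 2 by ring]
    exact isChain_cons_zig3 he (by rcases hτ with rfl | rfl <;> norm_num) _ m (link_cross he hτ e)
  | n + 1, e, m => by
    rw [ramp2_succ, ramp2_succ, List.cons_append, List.cons_append]
    refine List.isChain_cons_cons.mpr ⟨link_run he hτ e, ?_⟩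
    have := isChain_ramp2_zig3 hτ n (e + 2) m
    rwa [ramp2_succ, List.cons_append, show e + 2 + 2 * n + 2 = e + 2 * (n + 1) + 2 by ring] at this

end sweeps

/-! ### The family is a nonoverlapping expansion of precision-2 floats -/

/-- Every component of a kink block is a float. [cite: JeannerodRump2018, §1] -/
theorem isFloat_of_mem_zig3 (he : emin ≤ 0) : ∀ (n e : ℕ) (σ : ℚ), (σ = 1 ∨ σ = -1) →
    ∀ x ∈ zig3 σ e n, IsFloat 2 emin x
  | 0, e, σ, hσ, x, hx => by simp at hx
  | n + 1, e, σ, hσ, x, hx => by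
    rw [zig3_succ, List.mem_cons] at hx
    rcases hx with rfl | hx
    · exact isFloat2_sign_mul he hσ (Or.inr rfl) e
    · exact isFloat_of_mem_zig3 he n (e + 3) (-σ) (by rcases hσ with rfl | rfl <;> norm_num) x hx

/-- Every component of a run is a float. [cite: JeannerodRump2018, §1] -/
theorem isFloat_of_mem_ramp2 (he : emin ≤ 0) (hτ : τ = 1 ∨ τ = -1) : ∀ (n e : ℕ),
    ∀ x ∈ ramp2 τ e n, IsFloat 2 emin x
  | 0, e, x, hx => by simp at hx
  | n + 1, e, x, hx => by
    rw [ramp2_succ, List.mem_cons] at hx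
    rcases hx with rfl | hx
    · simpa using isFloat2_sign_mul he hτ (Or.inl rfl) e
    · exact isFloat_of_mem_ramp2 he hτ n (e + 2) x hx

/-- Kink components lie on the grid `2^e` and below `2^(e+3n)`. [cite: Shewchuk1997, §2.1] -/
theorem grid_of_mem_zig3 : ∀ (n e : ℕ) (σ : ℚ), (σ = 1 ∨ σ = -1) → ∀ x ∈ zig3 σ e n,
    OnGrid (e : ℤ) x ∧ |x| < (2 : ℚ) ^ (e + 3 * n)
  | 0, e, σ, hσ, x, hx => by simp at hx
  | n + 1, e, σ, hσ, x, hx => by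
    rw [zig3_succ, List.mem_cons] at hx
    rcases hx with rfl | hx
    · refine ⟨?_, ?_⟩
      · rcases hσ with rfl | rfl
        · exact ⟨3, by rw [zpow_natCast]; push_cast; ring⟩
        · exact ⟨-3, by rw [zpow_natCast]; push_cast; ring⟩
      · have h3 : |σ * 3 * (2 : ℚ) ^ e| = 3 * 2 ^ e := by
          rcases hσ with rfl | rfl <;> simp [abs_of_pos (show (0 : ℚ) < 3 * 2 ^ e by positivity)]
        rw [h3, show e + 3 * (n + 1) = e + 3 * n + 3 by ring, pow_add, pow_add]
        have : (0 : ℚ) < 2 ^ e := by positivity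
        have : (1 : ℚ) ≤ 2 ^ (3 * n) := one_le_pow₀ (by norm_num)
        nlinarith
    · obtain ⟨⟨r, hr⟩, hlt⟩ :=
        grid_of_mem_zig3 n (e + 3) (-σ) (by rcases hσ with rfl | rfl <;> norm_num) x hx
      refine ⟨⟨r * 8, ?_⟩, by rwa [show e + 3 * (n + 1) = e + 3 + 3 * n by ring]⟩
      rw [hr]; push_cast; rw [zpow_add₀ (by norm_num : (2 : ℚ) ≠ 0)]; norm_num; ring

/-- Run components lie on the grid `2^e`. [cite: Shewchuk1997, §2.1] -/
theorem grid_of_mem_ramp2 (hτ : τ = 1 ∨ τ = -1) : ∀ (n e : ℕ), ∀ x ∈ ramp2 τ e n, OnGrid (e : ℤ) x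
  | 0, e, x, hx => by simp at hx
  | n + 1, e, x, hx => by
    rw [ramp2_succ, List.mem_cons] at hx
    rcases hx with rfl | hx
    · rcases hτ with rfl | rfl
      · exact ⟨1, by rw [zpow_natCast]; push_cast; ring⟩
      · exact ⟨-1, by rw [zpow_natCast]; push_cast; ring⟩
    · obtain ⟨r, hr⟩ := grid_of_mem_ramp2 hτ n (e + 2) x hx
      refine ⟨r * 4, ?_⟩
      rw [hr]; push_cast; rw [zpow_add₀ (by norm_num : (2 : ℚ) ≠ 0)]; norm_num; ring

/-- A kink block is a nonoverlapping expansion. [cite: Shewchuk1997, §2.1 (nonoverlapping)] -/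
theorem isExpansion_zig3 : ∀ (n e : ℕ) (σ : ℚ), (σ = 1 ∨ σ = -1) → IsExpansion 1 (zig3 σ e n)
  | 0, e, σ, hσ => isExpansion_nil 1
  | n + 1, e, σ, hσ => by
    rw [zig3_succ, IsExpansion, List.pairwise_cons]
    have hσ' : -σ = 1 ∨ -σ = -1 := by rcases hσ with rfl | rfl <;> norm_num
    refine ⟨fun y hy => ?_, isExpansion_zig3 n (e + 3) (-σ) hσ'⟩
    obtain ⟨hg, -⟩ := grid_of_mem_zig3 n (e + 3) (-σ) hσ' y hy
    refine ⟨((e + 3 : ℕ) : ℤ), hg, ?_⟩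
    have h3 : |σ * 3 * (2 : ℚ) ^ e| = 3 * 2 ^ e := by
      rcases hσ with rfl | rfl <;> simp [abs_of_pos (show (0 : ℚ) < 3 * 2 ^ e by positivity)]
    rw [one_mul, h3, zpow_natCast, pow_add]
    have : (0 : ℚ) < 2 ^ e := by positivity
    nlinarith

/-- A run is a nonoverlapping expansion. [cite: Shewchuk1997, §2.1 (nonoverlapping)] -/
theorem isExpansion_ramp2 (hτ : τ = 1 ∨ τ = -1) : ∀ (n e : ℕ), IsExpansion 1 (ramp2 τ e n)
  | 0, e => isExpansion_nil 1
  | n + 1, e => by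
    rw [ramp2_succ, IsExpansion, List.pairwise_cons]
    refine ⟨fun y hy => ?_, isExpansion_ramp2 hτ n (e + 2)⟩
    refine ⟨((e + 2 : ℕ) : ℤ), grid_of_mem_ramp2 hτ n (e + 2) y hy, ?_⟩
    have h1 : |τ * (2 : ℚ) ^ e| = 2 ^ e := by
      rcases hτ with rfl | rfl <;> simp
    rw [one_mul, h1, zpow_natCast, pow_add]
    have : (0 : ℚ) < 2 ^ e := by positivity
    nlinarith

end Summit.Ventures.CertifiedArithmetic.Expansions
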